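import Summits.HodgeConjecture.HodgeConjecture.Theorems.Ring2AbelianAllAndreProductPencilsNodes
import HarnessLib

/-!
# Ring 2 · sub-cell AbelianAll (ALL ABELIAN VARIETIES), André axis, part XXXII-c — THE CELL ROWS IN THE MIDDLE DEGREE:
# `HC_AV ⟺ HC_CM ∧ (4)^mid` modulo Lemme 6.3.1 alone; `HC_AV ⟺ HC_CM ∧ (L)^mid` modulo [6.3.1, Verdier]; the verbatim middle
# restrictions of the typed nodes; and WHERE THE CONTENT STARTS — modulo [Verdier, Moonen–Zarhin 1999, Markman 2025] the first
# middle cell `(4, 2)` is closed, so the André-axis `B_min` starts at the cell `(6, 3)` and runs along the diagonal `(2m, m)`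

HONEST FRAMING (page 1, verbatim): **research route, not a corollary; conditional on HC_CM plus one named
minimal statement.** Cell line: research route conditional on HC_CM; not a corollary; Q11.4-sentence-2 already
refuted in dim ≥ 3. Nothing in this file proves a case of the Hodge conjecture for an abelian variety. `HC_CM`
(`Theses.RankFourFaces.CMAbelianHodge`) and `HC_AV` (`Theses.PadicSemiregularLift.HodgeAbelianVarieties`) are BINDERS
wherever they occur (inside `↔` or as hypotheses); `h₂₁` = Lemme 6.3.1, `h₂₂` = Lemmes 6.3.2–6.3.3, `hGT` = Verdier 1976,
`h01` = Moonen–Zarhin 1999, `hM` = Markman 2025 (unrefereed) are NAMED-FACT BINDERS, never facts; the reduction item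
`CMToAbelian` (stmt-16267) is NOT closed; the cell's `B_min` of record (N104) is untouched; NO node is born (file-local
notations as in part XXXII-b, plus the verbatim `LiftMidNode[k]`, `TransportMidNode[k]`); nothing is claimed minimal; 0 `def`,
0 `sorry`, axioms standard.

## What this part does

* §4 **`HC_AV ⟺ HC_CM ∧ (4)^mid` modulo André's Lemme 6.3.1 ALONE** (`HC_AV_iff_HC_CM_and_transportMid`: part I's exactness
  with (4) replaced by its fact-free equivalent middle form of part XXXII-b); the deliverable shape
  `HC_AV_of_HC_CM_of_transportMid (h₂₁) (hCM) (hmid)`; `cmToAbelian_iff_HC_CM_imp_transportMid`; on-path rows;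
  `HC_AV ⟺ HC_CM ∧ (L)^mid` modulo [6.3.1, Verdier]; the fact-free middle ladder `(L∀)^mid ⟹ (L)^mid ⟹ (4)^mid`,
  `(L∀)^mid ⟹ (2)^mid ⟹ (3)^mid ⟹ (4)^mid`; the KIND-1 witnesses `(2)^mid ⟹ HC_CM`, `(L∀)^mid ⟹ HC_CM` modulo 6.3.2–6.3.3
  (so, exactly as in part I, only (3)/(4)/(L) and their middle forms are `HC_CM`-complementary in the kernel).
* §5 WHERE THE CONTENT STARTS: `liftMid_iff_liftMid_succ_of_hcAtDim_of_verdier` — `HCAtDim (2k)` + Verdier move the diagonal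
  to `m ≥ k + 1`; **`cmFibreAlgebraicLift_iff_liftMid_three_of_verdier`** — modulo [Verdier, Moonen–Zarhin, Markman] the cell
  `(4, 2)` is closed and `(L) ⟺ (L)^mid_{≥3}`: the André-axis `B_min` STARTS AT `(6, 3)` — middle-dimensional invariant
  algebraic classes of CM abelian SIXFOLD fibres, the `(W_E)₃` habitat of the Weil seats (parts XV, XXVIII-e, XXXI-e) — and
  runs along `(8, 4), (10, 5), …`, onto which the padding maps every lower cell, `(d, p) ↦ (2d - 2p, d - p)` (`(6, 2) ↦ (8, 4)`);
  `HC_AV_iff_HC_CM_and_liftMid_three_of_verdier`; and, with NO Verdier, the transport form: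
  `transportMid_iff_transportMid_succ_of_hcAtDim`, **`cmAnchoredTransport_iff_transportMid_three_of_moonenZarhin_of_markman`**
  ((4) ⟺ (4)^mid_{≥3} modulo [Moonen–Zarhin, Markman] only) and **`HC_AV_iff_HC_CM_and_transportMid_three_of_moonenZarhin_of_markman`**
  — `HC_AV ⟺ HC_CM ∧ [on compact pencils of abelian varieties of even relative dimension 2m ≥ 6, a middle-degree class of the total
  space algebraic on a CM fibre is algebraic on every fibre]` modulo [Lemme 6.3.1, Moonen–Zarhin, Markman].
* §6 `liftMid_iff_liftMidNode`, `transportMid_iff_transportMidNode`, `nodes_iff_middleNodes` — the lattice / complex middle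
  forms agree with the VERBATIM middle restrictions of the typed nodes (rational `(m,m)` binders restored by parts XVII-a/b),
  FACT-FREE.

What is NOT claimed: that any single cell suffices; anything minimal; any case of HC; Markman 2025 is an announced,
unrefereed input and enters only §5's last two rows, as a binder. EDGE LABELS: §4 K / K[6.3.1] / K[6.3.1, Verdier] /
K[6.3.2–3] as displayed; §5 K[Verdier, HCAtDim] / K[Verdier, MZ99, Markman25]; §6 K.

References: Andre1996Motifs (§5.1 p. 25; §6.3 Lemmes 6.3.1–6.3.3 pp. 31–33, a) and Remarque 2 p. 33); Milne2020HodgeClassesAV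
(Prop. 1 p. 7); Abdulali1994FamiliesAV (Lemma 6.2 p. 1131); BrosnanFangNiePearlstein2009 (§6 Lemma 48); CharlesSchnell2014Notes
(Cor. 11.3.6 p. 494); Verdier1976 (Cor. (5.1)); MoonenZarhin1999LowDim (Thms. 0.1–0.2); Markman2025SecantWeil (Cor. 1.6.1);
GrothendieckTopology1969 (§1 pp. 299–300).
-/

noncomputable section

set_option linter.dupNamespace false

namespace Summit.HodgeConjecture.HodgeConjecture.Ring2.AbelianAll

open CategoryTheory CategoryTheory.Limits AlgebraicGeometry MonoidalCategory CartesianMonoidalCategory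
open Literature.AlgebraicGeometry Literature.AlgebraicGeometry.Motives
open Literature.AlgebraicGeometry.HodgeTheory
open Literature.AlgebraicGeometry.Deligne1982 (cmLocus)
open Literature.AlgebraicGeometry.Milne1999 (IsOfCMType)
open Literature.AlgebraicGeometry.Abdulali1994 (InvariantCyclesHoldFor)
open Literature.AlgebraicGeometry.Andre1996 (andre1996_cmAnchoredPencil
  andre1996_cmHodgeClasses_algebraicallyAnchoredPencils)
open Summit.HodgeConjecture.HodgeConjecture
open Summit.HodgeConjecture.HodgeConjecture.Theses
open Summit.HodgeConjecture.HodgeConjecture.Ring2.Deform (CompactAbelianPencilVHC HC_CM_of_HC_AV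
  HC_CM_of_andre1996_of_compactAbelianPencilVHC compactAbelianPencilVHC_of_HC_AV)
open Summit.HodgeConjecture.HodgeConjecture.Ring2.ClassTargets (HCAtDim hcAtDim_four_of_weilClassesFourfolds)

variable {𝒳 S : SchemeOver ℂ}

/-! ## §0 The middle-degree forms (file-local notations; nothing is defined or asserted) -/

/-- `(L)^mid_{≥k}` — the lift node (L) `CMFibreAlgebraicLift` in lattice form, RESTRICTED to the middle degree `2m` of compact
pencils of abelian varieties of even relative dimension `2m`, `k ≤ m` (file-local notation). -/
local notation3 (prettyPrint := false) "LiftMid[" k "]" =>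
  ∀ ⦃m : ℕ⦄ ⦃𝒳 S : SchemeOver ℂ⦄ (f : 𝒳 ⟶ S), IsCompactAbelianPencil f (2 * m) → k ≤ m →
    ∀ t ∈ cmLocus f (2 * m),
      (algebraicClasses (fiberOver f t) m).comap (complexBetti.map (fiberι f t) (2 * m)).hom ≤
        algebraicClasses 𝒳 m ⊔ LinearMap.ker (complexBetti.map (fiberι f t) (2 * m)).hom

/-- `(L∀)^mid_{≥k}` — the algebraic fixed part `AlgebraicFixedPart` in lattice form, restricted to the middle degree of
compact pencils of even relative dimension `2m`, `k ≤ m`, at EVERY point (file-local notation). -/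
local notation3 (prettyPrint := false) "FixedPartMid[" k "]" =>
  ∀ ⦃m : ℕ⦄ ⦃𝒳 S : SchemeOver ℂ⦄ (f : 𝒳 ⟶ S), IsCompactAbelianPencil f (2 * m) → k ≤ m →
    ∀ t : ComplexPoints S,
      (algebraicClasses (fiberOver f t) m).comap (complexBetti.map (fiberι f t) (2 * m)).hom ≤
        algebraicClasses 𝒳 m ⊔ LinearMap.ker (complexBetti.map (fiberι f t) (2 * m)).hom

/-- `(4)^mid_{≥k}` — CM-anchored transport `CMAnchoredTransport` on complex cohomology, restricted to the middle degree of
compact pencils of even relative dimension `2m`, `k ≤ m` (file-local notation). -/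
local notation3 (prettyPrint := false) "TransportMid[" k "]" =>
  ∀ ⦃m : ℕ⦄ ⦃𝒳 S : SchemeOver ℂ⦄ (f : 𝒳 ⟶ S), IsCompactAbelianPencil f (2 * m) → k ≤ m →
    ∀ (W : complexBetti 𝒳 (2 * m)), ∀ t ∈ cmLocus f (2 * m),
      complexBetti.map (fiberι f t) (2 * m) W ∈ algebraicClasses (fiberOver f t) m →
      ∀ s : ComplexPoints S, complexBetti.map (fiberι f s) (2 * m) W ∈ algebraicClasses (fiberOver f s) m

/-- `(2)^mid_{≥k}` — deform's `CompactAbelianPencilVHC` on complex cohomology, restricted to the middle degree of compact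
pencils of even relative dimension `2m`, `k ≤ m` (file-local notation). -/
local notation3 (prettyPrint := false) "VHCMid[" k "]" =>
  ∀ ⦃m : ℕ⦄ ⦃𝒳 S : SchemeOver ℂ⦄ (f : 𝒳 ⟶ S), IsCompactAbelianPencil f (2 * m) → k ≤ m →
    ∀ (W : complexBetti 𝒳 (2 * m)),
      (∃ s₀ : ComplexPoints S, complexBetti.map (fiberι f s₀) (2 * m) W ∈ algebraicClasses (fiberOver f s₀) m) →
      ∀ s : ComplexPoints S, complexBetti.map (fiberι f s) (2 * m) W ∈ algebraicClasses (fiberOver f s) m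

/-- `(3)^mid_{≥k}` — `CMPointedPencilVHC` on complex cohomology, restricted to the middle degree of CM-pointed compact
pencils of even relative dimension `2m`, `k ≤ m` (file-local notation). -/
local notation3 (prettyPrint := false) "PointedVHCMid[" k "]" =>
  ∀ ⦃m : ℕ⦄ ⦃𝒳 S : SchemeOver ℂ⦄ (f : 𝒳 ⟶ S), IsCompactAbelianPencil f (2 * m) → k ≤ m →
    (cmLocus f (2 * m)).Nonempty → ∀ (W : complexBetti 𝒳 (2 * m)),
      (∃ s₀ : ComplexPoints S, complexBetti.map (fiberι f s₀) (2 * m) W ∈ algebraicClasses (fiberOver f s₀) m) →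
      ∀ s : ComplexPoints S, complexBetti.map (fiberι f s) (2 * m) W ∈ algebraicClasses (fiberOver f s) m

/-- `(L)^mid_{≥k}` VERBATIM — the body of `CMFibreAlgebraicLift` with the binders `d = 2m`, `k ≤ m`, `p = m` inserted
(rational `(m,m)` fibre restrictions, existential lift; file-local notation). -/
local notation3 (prettyPrint := false) "LiftMidNode[" k "]" =>
  ∀ ⦃m : ℕ⦄ ⦃𝒳 S : SchemeOver ℂ⦄ (f : 𝒳 ⟶ S), IsCompactAbelianPencil f (2 * m) → k ≤ m →
    ∀ (W : complexBetti 𝒳 (2 * m)),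
      (∀ s : ComplexPoints S, IsRationalClass (complexBetti.map (fiberι f s) (2 * m) W) ∧
        IsOfHodgeType (2 * m) (fiberOver f s) (2 * m) m m (complexBetti.map (fiberι f s) (2 * m) W)) →
      ∀ t ∈ cmLocus f (2 * m),
        complexBetti.map (fiberι f t) (2 * m) W ∈ algebraicClasses (fiberOver f t) m →
        ∃ η ∈ algebraicClasses 𝒳 m,
          complexBetti.map (fiberι f t) (2 * m) η = complexBetti.map (fiberι f t) (2 * m) W

/-- `(4)^mid_{≥k}` VERBATIM — the body of `CMAnchoredTransport` with the binders `d = 2m`, `k ≤ m`, `p = m` inserted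
(rational `(m,m)` fibre restrictions; file-local notation). -/
local notation3 (prettyPrint := false) "TransportMidNode[" k "]" =>
  ∀ ⦃m : ℕ⦄ ⦃𝒳 S : SchemeOver ℂ⦄ (f : 𝒳 ⟶ S), IsCompactAbelianPencil f (2 * m) → k ≤ m →
    ∀ (W : complexBetti 𝒳 (2 * m)),
      (∀ s : ComplexPoints S, IsRationalClass (complexBetti.map (fiberι f s) (2 * m) W) ∧
        IsOfHodgeType (2 * m) (fiberOver f s) (2 * m) m m (complexBetti.map (fiberι f s) (2 * m) W)) →
      ∀ t ∈ cmLocus f (2 * m),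
        complexBetti.map (fiberι f t) (2 * m) W ∈ algebraicClasses (fiberOver f t) m →
        ∀ s : ComplexPoints S, complexBetti.map (fiberι f s) (2 * m) W ∈ algebraicClasses (fiberOver f s) m

/-! ## §4 The cell rows read in the middle degree -/

/-- **`HC_AV ⟺ HC_CM ∧ (4)^mid`, modulo André's Lemme 6.3.1 ALONE**: part I's exactness `HC_AV ⟺ HC_CM ∧ (4)` with (4)
replaced by its fact-free equivalent middle-degree form — `B_min` of the André axis is a statement about MIDDLE-dimensional
algebraic classes on CM fibres of compact pencils of even relative dimension `≥ 4`. research route, not a corollary;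
conditional on HC_CM plus one named minimal statement. [cite: Andre1996Motifs, Lemme 6.3.1 (p. 31) and §6.3 a) (p. 33)] -/
theorem HC_AV_iff_HC_CM_and_transportMid (h₂₁ : andre1996_cmAnchoredPencil) :
    PadicSemiregularLift.HodgeAbelianVarieties ↔ RankFourFaces.CMAbelianHodge ∧ TransportMid[2] := by
  rw [← cmAnchoredTransport_iff_transportMid]
  exact HC_AV_iff_HC_CM_and_cmAnchoredTransport h₂₁

/-- **`HC_AV_of_HC_CM_and_Bmin` with `B_min := (4)^mid`** (two hypotheses and Lemme 6.3.1). research route, not a corollary;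
conditional on HC_CM plus one named minimal statement. [cite: Andre1996Motifs, Lemme 6.3.1 (p. 31) and §6.3 a) (p. 33)] -/
theorem HC_AV_of_HC_CM_of_transportMid (h₂₁ : andre1996_cmAnchoredPencil) (hCM : RankFourFaces.CMAbelianHodge)
    (hmid : TransportMid[2]) : PadicSemiregularLift.HodgeAbelianVarieties :=
  HC_AV_of_HC_CM_and_Bmin h₂₁ hCM (cmAnchoredTransport_iff_transportMid.2 hmid)

/-- The reduction item in middle-degree form: `CMToAbelian ⟺ (HC_CM → (4)^mid)`, modulo Lemme 6.3.1.
[cite: Andre1996Motifs, Lemme 6.3.1 (p. 31)] -/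
theorem cmToAbelian_iff_HC_CM_imp_transportMid (h₂₁ : andre1996_cmAnchoredPencil) :
    RankFourFaces.CMToAbelian ↔ (RankFourFaces.CMAbelianHodge → TransportMid[2]) := by
  rw [← cmAnchoredTransport_iff_transportMid]
  exact cmToAbelian_iff_HC_CM_imp_cmAnchoredTransport h₂₁

/-- ON-PATH: `HC_AV ⟹ (4)^mid`. [cite: CharlesSchnell2014Notes, Cor. 11.3.6 (p. 494)] -/
theorem transportMid_of_HC_AV (h : PadicSemiregularLift.HodgeAbelianVarieties) : TransportMid[2] :=
  cmAnchoredTransport_iff_transportMid.1 (cmAnchoredTransport_of_HC_AV h)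

/-- ON-PATH: `HodgeConjecture ⟹ (4)^mid`. [folklore] -/
theorem transportMid_of_hodgeConjecture (h : _root_.HodgeConjecture) : TransportMid[2] :=
  cmAnchoredTransport_iff_transportMid.1 (cmAnchoredTransport_of_hodgeConjecture h)

/-- **`HC_AV ⟺ HC_CM ∧ (L)^mid` modulo [Lemme 6.3.1, Verdier]**: the cycle-theoretic `B_min` — "a middle-dimensional
invariant algebraic class of a CM fibre of a compact pencil of even relative dimension lifts to an algebraic class of the
total space" — is exact. research route, not a corollary; conditional on HC_CM plus one named minimal statement.
[cite: Andre1996Motifs, Lemme 6.3.1 (p. 31) and §5.1 (p. 25)] [cite: Verdier1976, Cor. (5.1)] [cite: Milne2020HodgeClassesAV, Prop. 1 (p. 7)] -/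
theorem HC_AV_iff_HC_CM_and_liftMid_of_verdier (h₂₁ : andre1996_cmAnchoredPencil)
    (hGT : Verdier1976_genericLocalTriviality) :
    PadicSemiregularLift.HodgeAbelianVarieties ↔ RankFourFaces.CMAbelianHodge ∧ LiftMid[2] := by
  rw [← cmFibreAlgebraicLift_iff_liftMid]
  exact HC_AV_iff_HC_CM_and_cmFibreAlgebraicLift_of_verdier h₂₁ hGT

/-- `CMToAbelian ⟺ (HC_CM → (L)^mid)` modulo [Lemme 6.3.1, Verdier]. [cite: Andre1996Motifs, Lemme 6.3.1 (p. 31)] [cite: Verdier1976, Cor. (5.1)] -/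
theorem cmToAbelian_iff_HC_CM_imp_liftMid_of_verdier (h₂₁ : andre1996_cmAnchoredPencil)
    (hGT : Verdier1976_genericLocalTriviality) :
    RankFourFaces.CMToAbelian ↔ (RankFourFaces.CMAbelianHodge → LiftMid[2]) := by
  rw [← cmFibreAlgebraicLift_iff_liftMid]
  exact cmToAbelian_iff_HC_CM_imp_cmFibreAlgebraicLift_of_verdier h₂₁ hGT

/-- ON-PATH modulo Verdier: `HC_AV ⟹ (L)^mid`. [cite: Verdier1976, Cor. (5.1)] [cite: CharlesSchnell2014Notes, Cor. 11.3.6] -/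
theorem liftMid_of_HC_AV_of_verdier (hGT : Verdier1976_genericLocalTriviality)
    (h : PadicSemiregularLift.HodgeAbelianVarieties) : LiftMid[2] :=
  cmFibreAlgebraicLift_iff_liftMid.1 (cmFibreAlgebraicLift_of_HC_AV_of_verdier hGT h)

/-- **The fact-free ladder in the middle degree**: `(L∀)^mid ⟹ (L)^mid ⟹ (4)^mid`, `(L∀)^mid ⟹ (2)^mid ⟹ (3)^mid ⟹ (4)^mid`
(part I's edges read through the equivalences of §2–§3). [cite: Andre1996Motifs, §6.3 a) and Remarque 2 (p. 33)] -/
theorem middleDegree_ladder :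
    (FixedPartMid[2] → LiftMid[2]) ∧ (LiftMid[2] → TransportMid[2]) ∧ (FixedPartMid[2] → VHCMid[2]) ∧
      (VHCMid[2] → PointedVHCMid[2]) ∧ (PointedVHCMid[2] → TransportMid[2]) :=
  ⟨fun h ↦ cmFibreAlgebraicLift_iff_liftMid.1
      (cmFibreAlgebraicLift_of_algebraicFixedPart (algebraicFixedPart_iff_fixedPartMid.2 h)),
    fun h ↦ cmAnchoredTransport_iff_transportMid.1
      (cmAnchoredTransport_of_cmFibreAlgebraicLift (cmFibreAlgebraicLift_iff_liftMid.2 h)),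
    fun h ↦ compactAbelianPencilVHC_iff_vhcMid.1
      (compactAbelianPencilVHC_of_algebraicFixedPart (algebraicFixedPart_iff_fixedPartMid.2 h)),
    fun h ↦ cmPointedPencilVHC_iff_pointedVHCMid.1
      (cmPointedPencilVHC_of_compactAbelianPencilVHC (compactAbelianPencilVHC_iff_vhcMid.2 h)),
    fun h ↦ cmAnchoredTransport_iff_transportMid.1
      (cmAnchoredTransport_of_cmPointedPencilVHC (cmPointedPencilVHC_iff_pointedVHCMid.2 h))⟩

/-- **KIND-1 witnesses in the middle degree**: granted Lemmes 6.3.2–6.3.3, `(2)^mid` and `(L∀)^mid` each already yield `HC_CM`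
(so next to them `HC_CM` would be idle) — exactly as for (2), (L∀) in part I. [cite: Andre1996Motifs, Lemmes 6.3.2–6.3.3 (pp. 32–33)] -/
theorem HC_CM_of_andre1996_of_vhcMid_or_fixedPartMid (h₂₂ : andre1996_cmHodgeClasses_algebraicallyAnchoredPencils) :
    (VHCMid[2] → RankFourFaces.CMAbelianHodge) ∧ (FixedPartMid[2] → RankFourFaces.CMAbelianHodge) :=
  ⟨fun h ↦ HC_CM_of_andre1996_of_compactAbelianPencilVHC h₂₂ (compactAbelianPencilVHC_iff_vhcMid.2 h),
    fun h ↦ HC_CM_of_andre1996_of_algebraicFixedPart h₂₂ (algebraicFixedPart_iff_fixedPartMid.2 h)⟩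

/-! ## §5 Where the middle-degree content starts -/

/-- **One rung of the diagonal**: if the lift holds in the middle degree `2k` at CM points of ALL compact pencils of relative
dimension `2k`, then `(L)^mid_{≥ k+1} ⟹ (L)^mid_{≥ k}`. [folklore] -/
theorem liftMid_of_liftMid_succ {k : ℕ} (h : LiftMid[k + 1])
    (hk : ∀ ⦃𝒳 S : SchemeOver ℂ⦄ (f : 𝒳 ⟶ S), IsCompactAbelianPencil f (2 * k) → ∀ t ∈ cmLocus f (2 * k),
      (algebraicClasses (fiberOver f t) k).comap (complexBetti.map (fiberι f t) (2 * k)).hom ≤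
        algebraicClasses 𝒳 k ⊔ LinearMap.ker (complexBetti.map (fiberι f t) (2 * k)).hom) :
    LiftMid[k] := by
  intro m 𝒳 S f hf hkm t ht
  rcases Nat.eq_or_lt_of_le hkm with heq | hlt
  · subst heq
    exact hk f hf t ht
  · exact h f hf (by omega) t ht

/-- **`HC` for abelian `2k`-folds + Verdier move the content to `m ≥ k + 1`**: `HCAtDim (2k) ⟹ ((L)^mid_{≥k} ⟺ (L)^mid_{≥k+1})`
(part XX-b `comap_le_sup_of_hcAtDim_of_verdier`). [cite: Verdier1976, Cor. (5.1)] [cite: CharlesSchnell2014Notes, Cor. 11.3.6] -/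
theorem liftMid_iff_liftMid_succ_of_hcAtDim_of_verdier (hGT : Verdier1976_genericLocalTriviality) {k : ℕ}
    (h : HCAtDim (2 * k)) : LiftMid[k] ↔ LiftMid[k + 1] :=
  ⟨fun hL _ _ _ f hf hm t ht ↦ hL f hf (by omega) t ht,
    fun hL ↦ liftMid_of_liftMid_succ hL fun _ _ f hf t _ ↦ comap_le_sup_of_hcAtDim_of_verdier hGT h hf _ t⟩

/-- **The first middle cell `(4, 2)` is closed modulo [Verdier, Moonen–Zarhin 1999, Markman 2025]: `(L) ⟺ (L)^mid_{≥3}`.**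
Granted those, the André-axis `B_min` STARTS AT THE CELL `(6, 3)` — middle-dimensional invariant algebraic classes of CM abelian
SIXFOLD fibres (the habitat of the Weil seats' `(W_E)₃`) — and continues along the diagonal `(8,4), (10,5), …`, which by the
padding also receives every lower cell (`(6,2) ↦ (8,4)` by `B = E`, `(d, p) ↦ (2d - 2p, d - p)`). NOT claimed: that any single
cell suffices. [cite: MoonenZarhin1999LowDim, Thms. 0.1–0.2] [cite: Markman2025SecantWeil, Cor. 1.6.1] [cite: Verdier1976, Cor. (5.1)] -/
theorem cmFibreAlgebraicLift_iff_liftMid_three_of_verdier (hGT : Verdier1976_genericLocalTriviality)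
    (h01 : MoonenZarhin1999_codimTwoHodgeClasses_abelianFourfold) (hM : Markman2025_weilClasses_algebraic_abelianFourfold) :
    CMFibreAlgebraicLift ↔ LiftMid[3] := by
  rw [cmFibreAlgebraicLift_iff_liftMid]
  exact liftMid_iff_liftMid_succ_of_hcAtDim_of_verdier hGT (k := 2) (hcAtDim_four_of_weilClassesFourfolds h01 hM)

/-- **`HC_AV ⟺ HC_CM ∧ (L)^mid_{≥3}` modulo [Lemme 6.3.1, Verdier, Moonen–Zarhin, Markman]** — the cell's deliverable shape with
`B_min` read on compact pencils of abelian varieties of even relative dimension `2m ≥ 6`, middle degree only. research route,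
not a corollary; conditional on HC_CM plus one named minimal statement. [cite: Andre1996Motifs, Lemme 6.3.1 (p. 31)]
[cite: MoonenZarhin1999LowDim, Thms. 0.1–0.2] [cite: Markman2025SecantWeil, Cor. 1.6.1] [cite: Verdier1976, Cor. (5.1)] -/
theorem HC_AV_iff_HC_CM_and_liftMid_three_of_verdier (h₂₁ : andre1996_cmAnchoredPencil)
    (hGT : Verdier1976_genericLocalTriviality) (h01 : MoonenZarhin1999_codimTwoHodgeClasses_abelianFourfold)
    (hM : Markman2025_weilClasses_algebraic_abelianFourfold) :
    PadicSemiregularLift.HodgeAbelianVarieties ↔ RankFourFaces.CMAbelianHodge ∧ LiftMid[3] := by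
  rw [← cmFibreAlgebraicLift_iff_liftMid_three_of_verdier hGT h01 hM]
  exact HC_AV_iff_HC_CM_and_cmFibreAlgebraicLift_of_verdier h₂₁ hGT

/-- **One rung of the diagonal, transport form**: transport out of CM fibres in the middle degree `2k` of ALL compact pencils of
relative dimension `2k` (complex form) gives `(4)^mid_{≥ k+1} ⟹ (4)^mid_{≥ k}`. [folklore] -/
theorem transportMid_of_transportMid_succ {k : ℕ} (h : TransportMid[k + 1])
    (hk : ∀ ⦃𝒳 S : SchemeOver ℂ⦄ (f : 𝒳 ⟶ S), IsCompactAbelianPencil f (2 * k) →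
      ∀ (W : complexBetti 𝒳 (2 * k)), ∀ t ∈ cmLocus f (2 * k),
        complexBetti.map (fiberι f t) (2 * k) W ∈ algebraicClasses (fiberOver f t) k →
        ∀ s : ComplexPoints S, complexBetti.map (fiberι f s) (2 * k) W ∈ algebraicClasses (fiberOver f s) k) :
    TransportMid[k] := by
  intro m 𝒳 S f hf hkm W t ht hW s
  rcases Nat.eq_or_lt_of_le hkm with heq | hlt
  · subst heq
    exact hk f hf W t ht hW s
  · exact h f hf (by omega) W t ht hW s

/-- **`HC` for abelian `2k`-folds moves the transport content to `m ≥ k + 1` — with NO Verdier**: `HCAtDim (2k) ⟹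
((4)^mid_{≥k} ⟺ (4)^mid_{≥k+1})` (every fibrewise rational `(k,k)` class is algebraic on every fibre, part XX-b
`forall_mem_algebraicClasses_of_hcAtDim`; complex classes by the rational span reduction of part XVII-b).
[cite: CharlesSchnell2014Notes, Cor. 11.3.6 (p. 494)] [cite: GrothendieckTopology1969, §1 pp. 299–300] -/
theorem transportMid_iff_transportMid_succ_of_hcAtDim {k : ℕ} (h : HCAtDim (2 * k)) :
    TransportMid[k] ↔ TransportMid[k + 1] := by
  refine ⟨fun hT _ _ _ f hf hm W t ht hW s ↦ hT f hf (by omega) W t ht hW s,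
    fun hT ↦ transportMid_of_transportMid_succ hT fun 𝒳 S f hf W t _ hW s ↦ ?_⟩
  refine (Submodule.span_le (p := (algebraicClasses (fiberOver f s) k).comap
      (complexBetti.map (fiberι f s) (2 * k)).hom)).2 ?_
    (mem_span_rational_of_map_fiberι_mem_algebraicClasses hf (p := k) hW)
  rintro W' ⟨hW', hW't⟩
  exact forall_mem_algebraicClasses_of_hcAtDim h hf W'
    (fibrewiseHodge_of_isRationalClass_of_mem_algebraicClasses hf (p := k) hW' hW't) s

/-- **(4) ⟺ (4)^mid_{≥3} modulo [Moonen–Zarhin 1999, Markman 2025] — NO Verdier, NO `HC_CM`**: granted the Hodge conjecture for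
abelian fourfolds (Moonen–Zarhin Thms. 0.1–0.2 with Markman's Weil-class claim, the tree's `hcAtDim_four_of_weilClassesFourfolds`),
CM-anchored transport on all compact pencils of abelian varieties in all degrees is equivalent to transport of MIDDLE-degree classes
out of CM fibres on compact pencils of even relative dimension `2m ≥ 6`. [cite: MoonenZarhin1999LowDim, Thms. 0.1–0.2]
[cite: Markman2025SecantWeil, Cor. 1.6.1] [cite: Andre1996Motifs, §6.3 a) (p. 33)] -/
theorem cmAnchoredTransport_iff_transportMid_three_of_moonenZarhin_of_markman
    (h01 : MoonenZarhin1999_codimTwoHodgeClasses_abelianFourfold) (hM : Markman2025_weilClasses_algebraic_abelianFourfold) :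
    CMAnchoredTransport ↔ TransportMid[3] := by
  rw [cmAnchoredTransport_iff_transportMid]
  exact transportMid_iff_transportMid_succ_of_hcAtDim (k := 2) (hcAtDim_four_of_weilClassesFourfolds h01 hM)

/-- **`HC_AV ⟺ HC_CM ∧ (4)^mid_{≥3}` modulo [Lemme 6.3.1, Moonen–Zarhin, Markman] — NO Verdier**: the cell's deliverable with
`B_min` := "on every compact pencil of abelian varieties of even relative dimension `2m ≥ 6`, a MIDDLE-degree class of the total space
algebraic on a CM fibre is algebraic on every fibre". Its first instance is the cell `(6, 3)`. research route, not a corollary;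
conditional on HC_CM plus one named minimal statement. [cite: Andre1996Motifs, Lemme 6.3.1 (p. 31) and §6.3 a) (p. 33)]
[cite: MoonenZarhin1999LowDim, Thms. 0.1–0.2] [cite: Markman2025SecantWeil, Cor. 1.6.1] -/
theorem HC_AV_iff_HC_CM_and_transportMid_three_of_moonenZarhin_of_markman (h₂₁ : andre1996_cmAnchoredPencil)
    (h01 : MoonenZarhin1999_codimTwoHodgeClasses_abelianFourfold) (hM : Markman2025_weilClasses_algebraic_abelianFourfold) :
    PadicSemiregularLift.HodgeAbelianVarieties ↔ RankFourFaces.CMAbelianHodge ∧ TransportMid[3] := by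
  rw [← cmAnchoredTransport_iff_transportMid_three_of_moonenZarhin_of_markman h01 hM]
  exact HC_AV_iff_HC_CM_and_cmAnchoredTransport h₂₁

/-- The deliverable shape with `B_min := (4)^mid_{≥3}`: `HC_CM → (4)^mid_{≥3} → HC_AV` modulo [6.3.1, Moonen–Zarhin, Markman].
research route, not a corollary; conditional on HC_CM plus one named minimal statement. [cite: Andre1996Motifs, Lemme 6.3.1 (p. 31)]
[cite: MoonenZarhin1999LowDim, Thms. 0.1–0.2] [cite: Markman2025SecantWeil, Cor. 1.6.1] -/
theorem HC_AV_of_HC_CM_of_transportMid_three_of_moonenZarhin_of_markman (h₂₁ : andre1996_cmAnchoredPencil)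
    (h01 : MoonenZarhin1999_codimTwoHodgeClasses_abelianFourfold) (hM : Markman2025_weilClasses_algebraic_abelianFourfold)
    (hCM : RankFourFaces.CMAbelianHodge) (hmid : TransportMid[3]) : PadicSemiregularLift.HodgeAbelianVarieties :=
  (HC_AV_iff_HC_CM_and_transportMid_three_of_moonenZarhin_of_markman h₂₁ h01 hM).2 ⟨hCM, hmid⟩

/-! ## §6 The verbatim middle-degree restrictions of the typed nodes -/

/-- **The lattice middle form and the VERBATIM middle restriction of (L) agree** (every `k`): rational `(m,m)` binders are
restored by part XVII-a (a rational global class algebraic on one fibre is fibrewise rational `(m,m)`) and the rational span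
reduction of part XVII-b. FACT-FREE. [cite: Andre1996Motifs, §5.1 (p. 25)] [cite: GrothendieckTopology1969, §1 pp. 299–300] -/
theorem liftMid_iff_liftMidNode (k : ℕ) : LiftMid[k] ↔ LiftMidNode[k] := by
  refine ⟨fun h m 𝒳 S f hf hk W _ t ht hW ↦ ?_, fun h m 𝒳 S f hf hk t ht W hW ↦ ?_⟩
  · obtain ⟨η, hη, κ, hκ, hsum⟩ := Submodule.mem_sup.1 (h f hf hk t ht hW)
    refine ⟨η, hη, ?_⟩
    rw [LinearMap.mem_ker] at hκ
    rw [← hsum, map_add]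
    change _ = complexBetti.map (fiberι f t) (2 * m) η + (complexBetti.map (fiberι f t) (2 * m)).hom κ
    rw [hκ, add_zero]
  · have hW' : complexBetti.map (fiberι f t) (2 * m) W ∈ algebraicClasses (fiberOver f t) m := hW
    refine (Submodule.span_le (p := algebraicClasses 𝒳 m ⊔
      LinearMap.ker (complexBetti.map (fiberι f t) (2 * m)).hom)).2 ?_
      (mem_span_rational_of_map_fiberι_mem_algebraicClasses hf (p := m) hW')
    rintro W' ⟨hW', hW't⟩
    obtain ⟨η, hη, hηt⟩ :=
      h f hf hk W' (fibrewiseHodge_of_isRationalClass_of_mem_algebraicClasses hf (p := m) hW' hW't) t ht hW't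
    change W' ∈ algebraicClasses 𝒳 m ⊔ LinearMap.ker (complexBetti.map (fiberι f t) (2 * m)).hom
    rw [show W' = η + (W' - η) by abel]
    refine Submodule.add_mem_sup hη ?_
    rw [LinearMap.mem_ker, map_sub, sub_eq_zero]
    exact hηt.symm

/-- **The complex middle form and the VERBATIM middle restriction of (4) agree** (every `k`). FACT-FREE.
[cite: Andre1996Motifs, §6.3 a) (p. 33)] [cite: GrothendieckTopology1969, §1 pp. 299–300] -/
theorem transportMid_iff_transportMidNode (k : ℕ) : TransportMid[k] ↔ TransportMidNode[k] := by
  refine ⟨fun h m 𝒳 S f hf hk W _ t ht hW s ↦ h f hf hk W t ht hW s, fun h m 𝒳 S f hf hk W t ht hW s ↦ ?_⟩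
  refine (Submodule.span_le (p := (algebraicClasses (fiberOver f s) m).comap
      (complexBetti.map (fiberι f s) (2 * m)).hom)).2 ?_
    (mem_span_rational_of_map_fiberι_mem_algebraicClasses hf (p := m) hW)
  rintro W' ⟨hW', hW't⟩
  exact h f hf hk W' (fibrewiseHodge_of_isRationalClass_of_mem_algebraicClasses hf (p := m) hW' hW't) t ht hW't s

/-- **(L) ⟺ its verbatim middle restriction; (4) ⟺ its verbatim middle restriction** — FACT-FREE. [cite: Andre1996Motifs, §5.1 and §6.3 a)]
[cite: BrosnanFangNiePearlstein2009, §6 Lemma 48] -/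
theorem nodes_iff_middleNodes :
    (CMFibreAlgebraicLift ↔ LiftMidNode[2]) ∧ (CMAnchoredTransport ↔ TransportMidNode[2]) :=
  ⟨cmFibreAlgebraicLift_iff_liftMid.trans (liftMid_iff_liftMidNode 2),
    cmAnchoredTransport_iff_transportMid.trans (transportMid_iff_transportMidNode 2)⟩

end Summit.HodgeConjecture.HodgeConjecture.Ring2.AbelianAll

end
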